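import Summits.CriticalPhenomena.SAWScalingLimit.Theorems.SAWDevelopingMapObservableToSLETypeLadderCarvedReductionSqueezeSelection
import Summits.CriticalPhenomena.SAWScalingLimit.Theorems.SAWDevelopingMapObservableToSLETypeLadderCarvedReductionSqueezeLattice2
import Summits.CriticalPhenomena.SAWScalingLimit.Theorems.SAWDevelopingMapObservableToSLETypeLadderCarvedReductionSqueezeDomainsCoreF
import Summits.CriticalPhenomena.SAWScalingLimit.Theorems.SAWDevelopingMapObservableToSLETypeLadderCarvedReductionSqueezeConfinedOuterHull
import HarnessLib

/-!
# T-A `carvedReduction_squeezeGeometry`: THE GEOMETRY OF THE MOVING-CARVING SQUEEZE, ASSEMBLED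
# (crux `SAWDevelopingMap.ObservableToSLE` stmt-CriticalPhenomena-10472, line `six-class-type-ladder`; = twin crux
# stmt-CriticalPhenomena-14005 stub T-A of 5a4″)

Landing target:
`Summits/CriticalPhenomena/SAWScalingLimit/Theorems/SAWDevelopingMapObservableToSLETypeLadderCarvedReductionSqueezeGeometry.lean`
(`--supports stmt-CriticalPhenomena-10472`; lead prover-line-stmt-CriticalPhenomena-10472-c5-0; registered carrier
`stub_carvedReduction_squeezeGeometry_TA` — the registered leaf `stub_carvedReduction_squeezeGeometry` (skeleton r8, 2026-08-17) has a
header longer than the gate's stored 3 900 characters, so it is landed under the plain name and wired in the skeleton by `exact`).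

`carvedReduction_squeezeGeometry` — for tame fat SOLID carved families with realised first good gates and a wide link, along any
subsequence: a further subsequence, ONE fixed two-piece flat Dobrushin domain `M` (pinned frame, boundary `η`-close to `D`), its
admissible lattice family `Λ'`, lattice translations carrying `Λ'` onto cells `Λ''ⱼ` of the carved domains (missing the removed levels,
no bad edge, containing the gate, gate mid-edges matched), AND the squeeze package of T-B (`TypeLadder.stub_carvedReduction_ratioSqueeze`,
p131716): outer two-piece flat Jordan approximant `E` with gate boxes, `E.IsHullSubdomain M`, chordal uniformizer, restriction datum with
`1 - ε' < d^{5/8}`, nested admissible families `Nf ⊇ Λ'`, outer containment of the carved walks, probability of the carved laws.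
It is pure GLUE over three landed stages:
* STAGE 1a `carvedReduction_squeezeGeometry_selection` (p137830): selection and pinning of the frame;
* STAGE 1b `carvedReduction_squeezeGeometry_domainsCoreF` (p162460, applied to the confined outer approximants
  `stub_carvedReduction_confinedOuterHull` p147799): the continuum geometry — super-domain `superSup` (p146087), limit bulk, fat connectors,
  monotone confined outer sequence, the twin's inner approximant contract `Squeeze.stub_carvedReduction_innerApproximant` (p144792), the
  frame `Squeeze.stub_carvedReduction_derivFrame` (p129409), (MD), (MU_F), (R);
* STAGE 2′ `carvedReduction_squeezeGeometry_lattice2` (p154374): the lattice half (nested deep families, cells, gates, containment).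
-/

noncomputable section

open scoped BigOperators Topology NNReal ENNReal Classical
open Filter Set MeasureTheory Metric
open Literature.Probability.LatticeModels (HexVertex hexGraph hexCenter triZeta triEmbed Site polyline)
open Literature.Probability.RandomPlanarGeometry
open Literature.Probability.RandomPlanarGeometry.SAW
open UpperHalfPlane (upperHalfPlaneSet)

namespace Summit.CriticalPhenomena.SAWScalingLimit.Theorems.ObservableToSLE.TypeLadder

open Summit.CriticalPhenomena.SAWScalingLimit.Theorems.ObservableToSLER.BridgeGate
open Summit.CriticalPhenomena.SAWScalingLimit.Theorems.ObservableToSLER.NestedGate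

/-- **Registered carrier `stub_carvedReduction_squeezeGeometry_TA`** (crux item stmt-CriticalPhenomena-10472, leaf T-A): the radii
bookkeeping of the assembled squeeze geometry — with box half-width `ρ/64`, box depth and flat radius `ρ/128`, the separation clause
`2 (ρc + ρc') + ρF ≤ dist (E.pt 0) (E.pt 1)` of STAGE 2′ holds as soon as the two limit gates are `ρ/16` apart. -/
theorem stub_carvedReduction_squeezeGeometry_TA :
    ∀ (ρ : ℝ) (P₀ P₁ : ℂ), 0 < ρ → ρ / 16 ≤ dist P₀ P₁ →
      2 * (ρ / 64 + ρ / 128) + ρ / 128 ≤ dist P₀ P₁ := by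
  intro ρ P₀ P₁ hρ h
  linarith

/-- STAGE 1 of T-A = STAGE 1b (`carvedReduction_squeezeGeometry_domainsCoreF` over `stub_carvedReduction_confinedOuterHull`) ∘
STAGE 1a (`carvedReduction_squeezeGeometry_selection`): the continuum geometry of the pinned frame from the hypotheses of T-A. -/
theorem carvedReduction_squeezeGeometry_continuum :
    (∀ (D : DobrushinDomain) (a b : ℝ → HexVertex), IsEmbEndpointApprox hexGraph hexCenter D a b →
      ∀ η > (0 : ℝ), ∃ R₀ > (0 : ℝ), ∀ R ∈ Set.Ioc (0 : ℝ) R₀, ∀ ρ > (0 : ℝ), ∀ N : ℕ,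
          ∀ (δ : ℕ → ℝ) (S T : ℕ → ℕ → Set HexVertex) (n n' : ℕ → ℕ) (q q' : ℕ → HexVertex),
            Tendsto δ atTop (𝓝[>] 0) →
            (∀ k, TameNestedFamily (δ k) R N (a (δ k)) (S k) ∧
              TameNestedFamily (δ k) R N (b (δ k)) (T k) ∧
              (((∀ i, ExteriorAnchored D.carrier (δ k) (S k i) (a (δ k))) ∧
          (∀ i, ExteriorAnchored D.carrier (δ k) (T k i) (b (δ k))) ∧
          (∀ (i : ℕ) (p q : HexVertex), HasCleanWindow D.carrier (δ k) ρ (S k i) p q →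
            rowOf 0 q = rowOf 0 p + 1 ∧
              ∀ x : HexVertex, ((δ k : ℝ) : ℂ) * hexCenter x ∈ ball (((δ k : ℝ) : ℂ) * hexCenter q) ρ →
                (x ∈ S k i ↔ rowOf 0 x ≤ rowOf 0 p)) ∧
          (∀ (i : ℕ) (p q : HexVertex), HasCleanWindow D.carrier (δ k) ρ (T k i) p q →
            rowOf 0 q = rowOf 0 p + 1 ∧
              ∀ x : HexVertex, ((δ k : ℝ) : ℂ) * hexCenter x ∈ ball (((δ k : ℝ) : ℂ) * hexCenter q) ρ →
                (x ∈ T k i ↔ rowOf 0 x ≤ rowOf 0 p))) ∧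
          (∀ (i : ℕ) (p q : HexVertex), HasCleanWindow D.carrier (δ k) ρ (S k i) p q →
            ∃ K : Set ℂ, IsCompact K ∧ IsConnected K ∧
              ((δ k : ℝ) : ℂ) * hexCenter q - ((ρ / 2 : ℝ) : ℂ) * Complex.I ∈ K ∧ ((δ k : ℝ) : ℂ) * hexCenter (a (δ k)) ∈ K ∧
              ∀ v : HexVertex, Metric.infDist (((δ k : ℝ) : ℂ) * hexCenter v) K ≤ ρ / 4 → v ∈ S k i) ∧
          (∀ (i : ℕ) (p q : HexVertex), HasCleanWindow D.carrier (δ k) ρ (T k i) p q →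
            ∃ K : Set ℂ, IsCompact K ∧ IsConnected K ∧
              ((δ k : ℝ) : ℂ) * hexCenter q - ((ρ / 2 : ℝ) : ℂ) * Complex.I ∈ K ∧ ((δ k : ℝ) : ℂ) * hexCenter (b (δ k)) ∈ K ∧
              ∀ v : HexVertex, Metric.infDist (((δ k : ℝ) : ℂ) * hexCenter v) K ≤ ρ / 4 → v ∈ T k i) ∧
          (∀ i : ℕ, ∃ K : Set ℂ, IsCompact K ∧ IsConnected K ∧ ((δ k : ℝ) : ℂ) * hexCenter (a (δ k)) ∈ K ∧
            (∀ v : HexVertex, Metric.infDist (((δ k : ℝ) : ℂ) * hexCenter v) K ≤ ρ / 8 → v ∈ S k i) ∧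
            (∀ v ∈ S k i, ∃ (t w : HexVertex) (r : ℕ), v ∈ hexBall t r ∧ w ∈ hexBall t r ∧
              hexBall t r ⊆ S k i ∧ Metric.infDist (((δ k : ℝ) : ℂ) * hexCenter w) K ≤ ρ / 16)) ∧
          (∀ i : ℕ, ∃ K : Set ℂ, IsCompact K ∧ IsConnected K ∧ ((δ k : ℝ) : ℂ) * hexCenter (b (δ k)) ∈ K ∧
            (∀ v : HexVertex, Metric.infDist (((δ k : ℝ) : ℂ) * hexCenter v) K ≤ ρ / 8 → v ∈ T k i) ∧
            (∀ v ∈ T k i, ∃ (t w : HexVertex) (r : ℕ), v ∈ hexBall t r ∧ w ∈ hexBall t r ∧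
              hexBall t r ⊆ T k i ∧ Metric.infDist (((δ k : ℝ) : ℂ) * hexCenter w) K ≤ ρ / 16)))) →
            (∀ k, ∃ (γ : HexDomainSAW D.carrier (δ k) (a (δ k)) (b (δ k))) (m : ℕ) (p : HexVertex)
                (m' : ℕ) (p' : HexVertex),
              IsFirstGoodGateN D.carrier (δ k) ρ R (S k) (a (δ k)) γ.walk.support (n k) m p (q k) ∧
              IsFirstGoodGateN D.carrier (δ k) ρ R (T k) (b (δ k)) γ.walk.support.reverse
                (n' k) m' p' (q' k) ∧
              WideLink D.carrier (δ k) ρ (S k (n k) ∪ T k (n' k)) (q k) (q' k)) →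
            ∀ ε' > (0 : ℝ), ∀ φ : ℕ → ℕ, StrictMono φ →
              ∃ (ψ₀ : ℕ → ℕ) (E M : DobrushinDomain) (τ : ℂ) (x : ℕ → Site 2)
                (φE : ConformalEquiv upperHalfPlaneSet E.carrier)
                (Φ : ConformalEquiv (upperHalfPlaneSet \ φE.pullbackHull M) upperHalfPlaneSet) (d : ℝ)
                (ρw ρc ρc' ρF : ℝ),
                (StrictMono ψ₀) ∧
                (StrictAnti fun j => δ (φ (ψ₀ j))) ∧
                (∀ j, 0 < δ (φ (ψ₀ j))) ∧
                (Tendsto (fun j => δ (φ (ψ₀ j))) atTop (𝓝[>] 0)) ∧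
                (Tendsto (fun j => ((δ (φ (ψ₀ j)) : ℝ) : ℂ) * triEmbed (x j)) atTop (𝓝 τ)) ∧
                (E.IsHullSubdomain M) ∧
                (∀ t : ℝ, dist (M.boundary t + τ) (D.boundary t) ≤ η) ∧
                (dist (M.pt 0 + τ) (D.pt 0) ≤ η) ∧
                (dist (M.pt 1 + τ) (D.pt 1) ≤ η) ∧
                (∀ i, E.carrier ∩ ball (E.pt i) ρw = {z : ℂ | (E.pt i).im < z.im} ∩ ball (E.pt i) ρw) ∧
                (∀ i (z : ℂ), |z.re - (E.pt i).re| ≤ ρc → (E.pt i).im - ρc' ≤ z.im → z.im ≤ (E.pt i).im → z ∉ E.carrier) ∧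
                (0 < ρc) ∧
                (0 < ρc') ∧
                (0 < ρF) ∧
                (ρF ≤ ρc) ∧
                (ρF ≤ ρc') ∧
                (ρF ≤ ρw) ∧
                (2 * (ρc + ρc') + ρF ≤ dist (E.pt 0) (E.pt 1)) ∧
                (E.IsChordalUniformizing φE) ∧
                (IsRestrictionMap (φE.pullbackHull M) Φ) ∧
                (HasRestrictionDeriv (φE.pullbackHull M) Φ d) ∧
                (1 - ε' < d ^ ((5 : ℝ) / 8)) ∧
                (∀ j, (q (φ (ψ₀ j))).2 = 0) ∧
                (∀ j, (q' (φ (ψ₀ j))).2 = 0) ∧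
                (Tendsto (fun j => ((δ (φ (ψ₀ j)) : ℝ) : ℂ) * hexCenter (((q (φ (ψ₀ j))).1 - x j, 0) : HexVertex)) atTop (𝓝 (E.pt 0))) ∧
                (Tendsto (fun j => ((δ (φ (ψ₀ j)) : ℝ) : ℂ) * hexCenter (((q' (φ (ψ₀ j))).1 - x j, 0) : HexVertex)) atTop (𝓝 (E.pt 1))) ∧
                (∀ j, (E.pt 0).im < (((δ (φ (ψ₀ j)) : ℝ) : ℂ) * hexCenter (((q (φ (ψ₀ j))).1 - x j, 0) : HexVertex)).im) ∧
                (∀ j, (E.pt 1).im < (((δ (φ (ψ₀ j)) : ℝ) : ℂ) * hexCenter (((q' (φ (ψ₀ j))).1 - x j, 0) : HexVertex)).im) ∧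
                (∀ᶠ j in atTop, ∀ v : HexVertex, ((δ (φ (ψ₀ j)) : ℝ) : ℂ) * hexCenter v - ((δ (φ (ψ₀ j)) : ℝ) : ℂ) * triEmbed (x j) ∈ ball (E.pt 0) ρF → (v ∈ S (φ (ψ₀ j)) (n (φ (ψ₀ j))) ∪ T (φ (ψ₀ j)) (n' (φ (ψ₀ j))) ↔ v.1 1 < (q (φ (ψ₀ j))).1 1)) ∧
                (∀ᶠ j in atTop, ∀ v : HexVertex, ((δ (φ (ψ₀ j)) : ℝ) : ℂ) * hexCenter v - ((δ (φ (ψ₀ j)) : ℝ) : ℂ) * triEmbed (x j) ∈ ball (E.pt 1) ρF → (v ∈ S (φ (ψ₀ j)) (n (φ (ψ₀ j))) ∪ T (φ (ψ₀ j)) (n' (φ (ψ₀ j))) ↔ v.1 1 < (q' (φ (ψ₀ j))).1 1)) ∧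
                (∀ᶠ j in atTop, ∀ z : ℂ, (z ∈ M.carrier ∨ ∃ i, dist z (E.pt i) ≤ 2 * ρc) → z + ((δ (φ (ψ₀ j)) : ℝ) : ℂ) * triEmbed (x j) ∈ D.carrier) ∧
                (∀ᶠ j in atTop, ∀ v : HexVertex, ((δ (φ (ψ₀ j)) : ℝ) : ℂ) * hexCenter v - ((δ (φ (ψ₀ j)) : ℝ) : ℂ) * triEmbed (x j) ∈ M.carrier → (∀ i, ρF ≤ dist (((δ (φ (ψ₀ j)) : ℝ) : ℂ) * hexCenter v - ((δ (φ (ψ₀ j)) : ℝ) : ℂ) * triEmbed (x j)) (E.pt i)) → v ∉ S (φ (ψ₀ j)) (n (φ (ψ₀ j))) ∪ T (φ (ψ₀ j)) (n' (φ (ψ₀ j)))) ∧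
                (∀ᶠ j in atTop, ∀ (w : HexVertex) (π : (hexDomainGraph D.carrier (δ (φ (ψ₀ j)))).Walk (q (φ (ψ₀ j))) w), (∀ y ∈ π.support, y ∉ S (φ (ψ₀ j)) (n (φ (ψ₀ j))) ∪ T (φ (ψ₀ j)) (n' (φ (ψ₀ j)))) → ∀ y ∈ π.support, ((δ (φ (ψ₀ j)) : ℝ) : ℂ) * hexCenter y - ((δ (φ (ψ₀ j)) : ℝ) : ℂ) * triEmbed (x j) ∈ E.carrier ∧ closedBall (((δ (φ (ψ₀ j)) : ℝ) : ℂ) * hexCenter y - ((δ (φ (ψ₀ j)) : ℝ) : ℂ) * triEmbed (x j)) (25 * δ (φ (ψ₀ j))) ⊆ E.carrier ∪ ⋃ i, {z : ℂ | |z.re - (E.pt i).re| ≤ ρc ∧ (E.pt i).im - 30 * δ (φ (ψ₀ j)) ≤ z.im ∧ z.im ≤ (E.pt i).im} ∧ (|(((δ (φ (ψ₀ j)) : ℝ) : ℂ) * hexCenter y - ((δ (φ (ψ₀ j)) : ℝ) : ℂ) * triEmbed (x j)).re - (E.pt 0).re| < ρc + 10 * δ (φ (ψ₀ j)) → |(((δ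 (φ (ψ₀ j)) : ℝ) : ℂ) * hexCenter y - ((δ (φ (ψ₀ j)) : ℝ) : ℂ) * triEmbed (x j)).im - (E.pt 0).im| < ρc' → (q (φ (ψ₀ j))).1 1 ≤ y.1 1) ∧ (|(((δ (φ (ψ₀ j)) : ℝ) : ℂ) * hexCenter y - ((δ (φ (ψ₀ j)) : ℝ) : ℂ) * triEmbed (x j)).re - (E.pt 1).re| < ρc + 10 * δ (φ (ψ₀ j)) → |(((δ (φ (ψ₀ j)) : ℝ) : ℂ) * hexCenter y - ((δ (φ (ψ₀ j)) : ℝ) : ℂ) * triEmbed (x j)).im - (E.pt 1).im| < ρc' → (q' (φ (ψ₀ j))).1 1 ≤ y.1 1)) ∧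
                (∀ j, q (φ (ψ₀ j)) ∈ embMeshDomain hexGraph hexCenter D.carrier (δ (φ (ψ₀ j)))) ∧
                (∀ᶠ j in atTop, IsProbabilityMeasure (carvedLaw D.carrier (δ (φ (ψ₀ j))) (S (φ (ψ₀ j)) (n (φ (ψ₀ j))) ∪ T (φ (ψ₀ j)) (n' (φ (ψ₀ j)))) (q (φ (ψ₀ j))) (q' (φ (ψ₀ j)))))) := by
  intro D a b hab η hη
  obtain ⟨Ra, hRa, hsel⟩ := carvedReduction_squeezeGeometry_selection D a b hab
  obtain ⟨Rb, hRb, hdom⟩ :=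
    carvedReduction_squeezeGeometry_domainsCoreF stub_carvedReduction_confinedOuterHull D a b hab η hη
  refine ⟨min Ra Rb, lt_min hRa hRb, fun R hR ρ hρ N δ S T n n' q q' hδ hfam hgates ε' hε' φ hφ => ?_⟩
  obtain ⟨ψ₀, x, τ, P₀, P₁, hfacts⟩ :=
    hsel R ⟨hR.1, hR.2.trans (min_le_left _ _)⟩ ρ hρ N δ S T n n' q q' hδ hfam hgates φ hφ
  exact hdom R ⟨hR.1, hR.2.trans (min_le_right _ _)⟩ ρ hρ N δ S T n n' q q' hδ hfam hgates ε' hε' φ hφ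
    ψ₀ x τ P₀ P₁ hfacts

/-- **T-A `carvedReduction_squeezeGeometry` — the geometry of the moving-carving squeeze for solid families** (see the module
docstring): all hypotheses of T2b″ except ARL″ give the conclusion data (C1)–(C8) of the solid moving-carving squeeze AND the squeeze
package consumed by T-B.  GLUE: STAGE 2′ ∘ STAGE 1. -/
theorem carvedReduction_squeezeGeometry :
    (∀ (D : DobrushinDomain) (a b : ℝ → HexVertex), IsEmbEndpointApprox hexGraph hexCenter D a b →
      ∀ η > (0 : ℝ), ∃ R₀ > (0 : ℝ), ∀ R ∈ Set.Ioc (0 : ℝ) R₀, ∀ ρ > (0 : ℝ), ∀ N : ℕ,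
          ∀ (δ : ℕ → ℝ) (S T : ℕ → ℕ → Set HexVertex) (n n' : ℕ → ℕ) (q q' : ℕ → HexVertex),
            Tendsto δ atTop (𝓝[>] 0) →
            (∀ k, TameNestedFamily (δ k) R N (a (δ k)) (S k) ∧
              TameNestedFamily (δ k) R N (b (δ k)) (T k) ∧
              (((∀ i, ExteriorAnchored D.carrier (δ k) (S k i) (a (δ k))) ∧
          (∀ i, ExteriorAnchored D.carrier (δ k) (T k i) (b (δ k))) ∧
          (∀ (i : ℕ) (p q : HexVertex), HasCleanWindow D.carrier (δ k) ρ (S k i) p q →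
            rowOf 0 q = rowOf 0 p + 1 ∧
              ∀ x : HexVertex, ((δ k : ℝ) : ℂ) * hexCenter x ∈ ball (((δ k : ℝ) : ℂ) * hexCenter q) ρ →
                (x ∈ S k i ↔ rowOf 0 x ≤ rowOf 0 p)) ∧
          (∀ (i : ℕ) (p q : HexVertex), HasCleanWindow D.carrier (δ k) ρ (T k i) p q →
            rowOf 0 q = rowOf 0 p + 1 ∧
              ∀ x : HexVertex, ((δ k : ℝ) : ℂ) * hexCenter x ∈ ball (((δ k : ℝ) : ℂ) * hexCenter q) ρ →
                (x ∈ T k i ↔ rowOf 0 x ≤ rowOf 0 p))) ∧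
          (∀ (i : ℕ) (p q : HexVertex), HasCleanWindow D.carrier (δ k) ρ (S k i) p q →
            ∃ K : Set ℂ, IsCompact K ∧ IsConnected K ∧
              ((δ k : ℝ) : ℂ) * hexCenter q - ((ρ / 2 : ℝ) : ℂ) * Complex.I ∈ K ∧ ((δ k : ℝ) : ℂ) * hexCenter (a (δ k)) ∈ K ∧
              ∀ v : HexVertex, Metric.infDist (((δ k : ℝ) : ℂ) * hexCenter v) K ≤ ρ / 4 → v ∈ S k i) ∧
          (∀ (i : ℕ) (p q : HexVertex), HasCleanWindow D.carrier (δ k) ρ (T k i) p q →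
            ∃ K : Set ℂ, IsCompact K ∧ IsConnected K ∧
              ((δ k : ℝ) : ℂ) * hexCenter q - ((ρ / 2 : ℝ) : ℂ) * Complex.I ∈ K ∧ ((δ k : ℝ) : ℂ) * hexCenter (b (δ k)) ∈ K ∧
              ∀ v : HexVertex, Metric.infDist (((δ k : ℝ) : ℂ) * hexCenter v) K ≤ ρ / 4 → v ∈ T k i) ∧
          (∀ i : ℕ, ∃ K : Set ℂ, IsCompact K ∧ IsConnected K ∧ ((δ k : ℝ) : ℂ) * hexCenter (a (δ k)) ∈ K ∧
            (∀ v : HexVertex, Metric.infDist (((δ k : ℝ) : ℂ) * hexCenter v) K ≤ ρ / 8 → v ∈ S k i) ∧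
            (∀ v ∈ S k i, ∃ (t w : HexVertex) (r : ℕ), v ∈ hexBall t r ∧ w ∈ hexBall t r ∧
              hexBall t r ⊆ S k i ∧ Metric.infDist (((δ k : ℝ) : ℂ) * hexCenter w) K ≤ ρ / 16)) ∧
          (∀ i : ℕ, ∃ K : Set ℂ, IsCompact K ∧ IsConnected K ∧ ((δ k : ℝ) : ℂ) * hexCenter (b (δ k)) ∈ K ∧
            (∀ v : HexVertex, Metric.infDist (((δ k : ℝ) : ℂ) * hexCenter v) K ≤ ρ / 8 → v ∈ T k i) ∧
            (∀ v ∈ T k i, ∃ (t w : HexVertex) (r : ℕ), v ∈ hexBall t r ∧ w ∈ hexBall t r ∧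
              hexBall t r ⊆ T k i ∧ Metric.infDist (((δ k : ℝ) : ℂ) * hexCenter w) K ≤ ρ / 16)))) →
            (∀ k, ∃ (γ : HexDomainSAW D.carrier (δ k) (a (δ k)) (b (δ k))) (m : ℕ) (p : HexVertex)
                (m' : ℕ) (p' : HexVertex),
              IsFirstGoodGateN D.carrier (δ k) ρ R (S k) (a (δ k)) γ.walk.support (n k) m p (q k) ∧
              IsFirstGoodGateN D.carrier (δ k) ρ R (T k) (b (δ k)) γ.walk.support.reverse
                (n' k) m' p' (q' k) ∧
              WideLink D.carrier (δ k) ρ (S k (n k) ∪ T k (n' k)) (q k) (q' k)) →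
            ∀ ε' > (0 : ℝ), ∀ φ : ℕ → ℕ, StrictMono φ →
              ∃ (ψ : ℕ → ℕ) (M : DobrushinDomain) (τ : ℂ) (ρ' : ℝ) (Λ' : ℝ → Finset HexVertex)
                (m : Fin 2 → ℝ → ℤ) (a' b' : ℝ → Sym2 HexVertex) (x : ℕ → Site 2)
                (Λ'' : ℕ → Finset HexVertex) (pu pv : ℕ → HexVertex),
                StrictMono ψ ∧
                (∀ t : ℝ, dist (M.boundary t + τ) (D.boundary t) ≤ η) ∧
                dist (M.pt 0 + τ) (D.pt 0) ≤ η ∧ dist (M.pt 1 + τ) (D.pt 1) ≤ η ∧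
                (0 < ρ' ∧ ∀ i : Fin 2,
                  M.carrier ∩ ball (M.pt i) ρ' = {z : ℂ | (M.pt i).im < z.im} ∩ ball (M.pt i) ρ') ∧
                (∀ᶠ δ' : ℝ in 𝓝[>] 0, hexDomainSimplyConnected (Λ' δ') ∧
                  a' δ' ∈ hexDomainBoundary (Λ' δ') ∧ b' δ' ∈ hexDomainBoundary (Λ' δ') ∧
                  Nonempty (HexMidEdgeSAW (Λ' δ') (a' δ') (b' δ')) ∧
                  (hexGraph.induce (↑(Λ' δ') : Set HexVertex)).Preconnected ∧
                  (∀ v ∈ Λ' δ', (δ' : ℂ) * hexCenter v ∈ M.carrier) ∧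
                  (∀ i : Fin 2, ∀ v : HexVertex, (δ' : ℂ) * hexCenter v ∈ ball (M.pt i) ρ' →
                    (v ∈ Λ' δ' ↔ m i δ' ≤ v.1 1))) ∧
                (∀ K : Set ℂ, IsCompact K → K ⊆ M.carrier →
                  ∀ᶠ δ' : ℝ in 𝓝[>] 0, ∀ v : HexVertex, (δ' : ℂ) * hexCenter v ∈ K → v ∈ Λ' δ') ∧
                Tendsto (fun δ' : ℝ => (δ' : ℂ) * hexMidpoint (a' δ')) (𝓝[>] 0) (𝓝 (M.pt 0)) ∧
                Tendsto (fun δ' : ℝ => (δ' : ℂ) * hexMidpoint (b' δ')) (𝓝[>] 0) (𝓝 (M.pt 1)) ∧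
                Tendsto (fun j : ℕ => ((δ (φ (ψ j)) : ℝ) : ℂ) *
                  Literature.Probability.LatticeModels.triEmbed (x j)) atTop (𝓝 τ) ∧
                (∀ j : ℕ,
                  (∀ w : HexVertex, w ∈ Λ'' j ↔ ((-(x j) + w.1, w.2) : HexVertex) ∈ Λ' (δ (φ (ψ j)))) ∧
                  (∀ w ∈ Λ'' j, w ∉ S (φ (ψ j)) (n (φ (ψ j))) ∪ T (φ (ψ j)) (n' (φ (ψ j)))) ∧
                  (∀ w ∈ Λ'' j, ∀ y ∈ Λ'' j, hexGraph.Adj w y →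
                    (hexDomainGraph D.carrier (δ (φ (ψ j)))).Adj w y) ∧
                  q (φ (ψ j)) ∈ Λ'' j ∧
                  pu j ∈ S (φ (ψ j)) (n (φ (ψ j))) ∪ T (φ (ψ j)) (n' (φ (ψ j))) ∧
                  pv j ∈ S (φ (ψ j)) (n (φ (ψ j))) ∪ T (φ (ψ j)) (n' (φ (ψ j))) ∧
                  hexGraph.Adj (q (φ (ψ j))) (pu j) ∧
                  s(q (φ (ψ j)), pu j) ≠ s(q' (φ (ψ j)), pv j) ∧
                  (a' (δ (φ (ψ j)))).map (fun w : HexVertex => ((x j + w.1, w.2) : HexVertex)) =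
                    s(q (φ (ψ j)), pu j) ∧
                  (b' (δ (φ (ψ j)))).map (fun w : HexVertex => ((x j + w.1, w.2) : HexVertex)) =
                    s(q' (φ (ψ j)), pv j)) ∧
                ∃ (E : DobrushinDomain) (ρE : ℝ) (φE : ConformalEquiv upperHalfPlaneSet E.carrier)
                  (Φ : ConformalEquiv (upperHalfPlaneSet \ φE.pullbackHull M) upperHalfPlaneSet) (d : ℝ)
                  (Nf : ℝ → Finset HexVertex) (m₀ m₁ m₁' : ℝ → ℤ),
                  (0 < ρE ∧ ∀ i : Fin 2,
                    E.carrier ∩ ball (E.pt i) ρE = {z : ℂ | (E.pt i).im < z.im} ∩ ball (E.pt i) ρE) ∧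
                  E.IsHullSubdomain M ∧ E.IsChordalUniformizing φE ∧
                  IsRestrictionMap (φE.pullbackHull M) Φ ∧ HasRestrictionDeriv (φE.pullbackHull M) Φ d ∧
                  1 - ε' < d ^ ((5 : ℝ) / 8) ∧
                  (∀ᶠ δ' : ℝ in 𝓝[>] 0,
                    Λ' δ' ⊆ Nf δ' ∧ hexDomainSimplyConnected (Nf δ') ∧ hexDomainSimplyConnected (Λ' δ') ∧
                    (hexGraph.induce (↑(Nf δ') : Set HexVertex)).Preconnected ∧
                    (hexGraph.induce (↑(Λ' δ') : Set HexVertex)).Preconnected ∧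
                    a' δ' ∈ hexDomainBoundary (Nf δ') ∧ b' δ' ∈ hexDomainBoundary (Nf δ') ∧
                    a' δ' ∈ hexDomainBoundary (Λ' δ') ∧ b' δ' ∈ hexDomainBoundary (Λ' δ') ∧
                    Nonempty (HexMidEdgeSAW (Λ' δ') (a' δ') (b' δ')) ∧
                    (∀ w ∈ Nf δ', (δ' : ℂ) * hexCenter w ∈ E.carrier) ∧
                    (∀ w ∈ Λ' δ', (δ' : ℂ) * hexCenter w ∈ M.carrier) ∧
                    (∀ w : HexVertex, (δ' : ℂ) * hexCenter w ∈ ball (E.pt 0) ρE →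
                      ((w ∈ Nf δ' ↔ m₀ δ' ≤ w.1 1) ∧ (w ∈ Λ' δ' ↔ m₀ δ' ≤ w.1 1))) ∧
                    (∀ w : HexVertex, (δ' : ℂ) * hexCenter w ∈ ball (E.pt 1) ρE →
                      ((w ∈ Nf δ' ↔ m₁ δ' ≤ w.1 1) ∧ (w ∈ Λ' δ' ↔ m₁' δ' ≤ w.1 1)))) ∧
                  (∀ K : Set ℂ, IsCompact K → K ⊆ E.carrier →
                    ∀ᶠ δ' : ℝ in 𝓝[>] 0, ∀ w : HexVertex, (δ' : ℂ) * hexCenter w ∈ K → w ∈ Nf δ') ∧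
                  (∀ K : Set ℂ, IsCompact K → K ⊆ M.carrier →
                    ∀ᶠ δ' : ℝ in 𝓝[>] 0, ∀ w : HexVertex, (δ' : ℂ) * hexCenter w ∈ K → w ∈ Λ' δ') ∧
                  Tendsto (fun δ' : ℝ => (δ' : ℂ) * hexMidpoint (a' δ')) (𝓝[>] 0) (𝓝 (E.pt 0)) ∧
                  Tendsto (fun δ' : ℝ => (δ' : ℂ) * hexMidpoint (b' δ')) (𝓝[>] 0) (𝓝 (E.pt 1)) ∧
                  (∀ᶠ j : ℕ in atTop,
                    IsProbabilityMeasure (carvedLaw D.carrier (δ (φ (ψ j)))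
                      (S (φ (ψ j)) (n (φ (ψ j))) ∪ T (φ (ψ j)) (n' (φ (ψ j)))) (q (φ (ψ j))) (q' (φ (ψ j)))) ∧
                    (∀ w : HexVertex, w ∈ Λ'' j ↔ ((-(x j) + w.1, w.2) : HexVertex) ∈ Λ' (δ (φ (ψ j)))) ∧
                    (∀ w ∈ Λ'' j, w ∉ S (φ (ψ j)) (n (φ (ψ j))) ∪ T (φ (ψ j)) (n' (φ (ψ j)))) ∧
                    (∀ w ∈ Λ'' j, ∀ y ∈ Λ'' j, hexGraph.Adj w y →
                      (hexDomainGraph D.carrier (δ (φ (ψ j)))).Adj w y) ∧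
                    q (φ (ψ j)) ∈ Λ'' j ∧
                    pu j ∈ S (φ (ψ j)) (n (φ (ψ j))) ∪ T (φ (ψ j)) (n' (φ (ψ j))) ∧
                    pv j ∈ S (φ (ψ j)) (n (φ (ψ j))) ∪ T (φ (ψ j)) (n' (φ (ψ j))) ∧
                    hexGraph.Adj (q (φ (ψ j))) (pu j) ∧
                    s(q (φ (ψ j)), pu j) ≠ s(q' (φ (ψ j)), pv j) ∧
                    (a' (δ (φ (ψ j)))).map (fun w : HexVertex => ((x j + w.1, w.2) : HexVertex)) =
                      s(q (φ (ψ j)), pu j) ∧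
                    (b' (δ (φ (ψ j)))).map (fun w : HexVertex => ((x j + w.1, w.2) : HexVertex)) =
                      s(q' (φ (ψ j)), pv j) ∧
                    (∀ (w : HexVertex) (π : (hexDomainGraph D.carrier (δ (φ (ψ j)))).Walk (q (φ (ψ j))) w),
                      (∀ y ∈ π.support, y ∉ S (φ (ψ j)) (n (φ (ψ j))) ∪ T (φ (ψ j)) (n' (φ (ψ j)))) →
                        ∀ y ∈ π.support, ((-(x j) + y.1, y.2) : HexVertex) ∈ Nf (δ (φ (ψ j)))) ∧
                    ((-(x j) + (pu j).1, (pu j).2) : HexVertex) ∉ Nf (δ (φ (ψ j))) ∧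
                    ((-(x j) + (pv j).1, (pv j).2) : HexVertex) ∉ Nf (δ (φ (ψ j))))) := by
  intro D a b hab η hη
  obtain ⟨R₀, hR₀, hgeo⟩ := carvedReduction_squeezeGeometry_continuum D a b hab η hη
  refine ⟨R₀, hR₀, fun R hR ρ hρ N δ S T n n' q q' hδ hfam hgates ε' hε' φ hφ => ?_⟩
  obtain ⟨ψ₀, E, M, τ, x, φE, Φ, d, ρw, ρc, ρc', ρF, hψ₀, hsanti, hspos, hs0, hτ, hM, hbd, hbd0, hbd1,
    hflat, hB, hρc, hρc', hρF, hFc, hFc', hFw, hsep, hφE, hΦ, hd, hlev, hq0, hq1, hconv0, hconv1,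
    habove0, habove1, hU0, hU1, hMD, hMU, hreach, hqdom, hprob⟩ :=
    hgeo R hR ρ hρ N δ S T n n' q q' hδ hfam hgates ε' hε' φ hφ
  exact carvedReduction_squeezeGeometry_lattice2 D δ S T n n' q q' η ε' φ ψ₀ E M τ x φE Φ d ρw ρc ρc' ρF
    hψ₀ hsanti hspos hs0 hτ hM hbd hbd0 hbd1 hflat hB hρc hρc' hρF hFc hFc' hFw hsep hφE hΦ hd hlev hq0 hq1
    hconv0 hconv1 habove0 habove1 hU0 hU1 hMD hMU hreach hqdom hprob

end Summit.CriticalPhenomena.SAWScalingLimit.Theorems.ObservableToSLE.TypeLadder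

end
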